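import Summits.BirchSwinnertonDyer.BirchSwinnertonDyer.Theorems.GenusKolyvaginAtTwoGenusPrimitiveSupplyAtTwoTwistingPrimeEntangledDisentangled
import Summits.BirchSwinnertonDyer.BirchSwinnertonDyer.Theorems.GenusKolyvaginAtTwoPowDvdShaCardAtTwoRTGenusBudgetPrimeDisc
import Summits.BirchSwinnertonDyer.BirchSwinnertonDyer.Theorems.GenusKolyvaginAtTwoMazurRubinCor34iSingleton
import Summits.BirchSwinnertonDyer.BirchSwinnertonDyer.Theorems.GenusKolyvaginAtTwoGenusPrimitiveSupplyAtTwoUnconditional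
import Summits.BirchSwinnertonDyer.BirchSwinnertonDyer.Theorems.SchneiderFreeAdditiveX3PoitouTateReciprocitySumHolds
import Summits.BirchSwinnertonDyer.Rank1Residual.GaloisImage.LocalEulerPoincareCharacteristicHolds
import HarnessLib

/-!
# Route `GenusKolyvaginAtTwo`, crux #2 `GenusPrimitiveSupplyAtTwo` (stmt-BirchSwinnertonDyer-22136):
# THE PRIME-HEEGNER-FIELD DEPTH SUPPLY IS UNCONDITIONAL, AND IT DELIVERS THE HABITAT CUT (E1) «B = ord₂ C(Wd) = 1» AND
# INDEX-≥M KOLYVAGIN PRIMES (β″) FOR LINE 18 — the supply lineage's answer to the LEAD's question on (E1)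

Width seat `bsd-line-gk2-p5` g20 (cell `bsd-f1-sign2`, SUPPLY lineage). THEOREMS ONLY (no definition, no named fact, no `sorry`);
helper `--supports stmt-BirchSwinnertonDyer-22136`; no item is closed; BSD is not proved by any of this.

WHY. LINE 18 (`plus_descent` v5.1 on L_T `PowDvdShaCardAtTwoRT`, stmt-BirchSwinnertonDyer-23242) has two open arithmetic fronts, BOTH living
on the DEEP-GENUS regime `B := ord₂ C(Wd) ≥ 2` (registered stub `stub_twinExhibitionGenusDeep`; the bottom-rung residual R⁽¹⁾ of the LEAD's
memo `Lines/plus-descent-lead-g16.md` §3–§5), and the four gk2 seats' consensus recommendation to the pen is the habitat cut (E1) «B = 1»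
together with (β″) «the primitive level `n` consists of Kolyvagin primes of index ≥ 2». The LEAD (STATUS 2026-08-29T06:13:27Z) asked the
SUPPLY lineage whether (E1) is compatible with the supply mechanism of crux 22136. This file answers BY NAME: the tree's depth supply of the
twisting-prime series (gk2-p4 g10 `GenusKolyTwistingPrime.exists_prime_heegnerField_minimalTwin_depth_supply_of_cor34i`) produces, for every
globally minimal `W` with `Δ_W < 0`, `2`-adic tower onto and `#Sel₂(W) = 4` (= every row of the cell's X5 `Δ < 0` instrument: 858/858 rows
have `dim Sel₂(W) = dim Ш(W)[2] = 2`), a PRIME Heegner field `K = ℚ(√−ℓ₀)`; and for prime `|d_K|` the genus budget is exactly one bit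
(gk2-p2 g17 `GenusExact.PlusDescent.padicValNat_two_tamagawaProduct_twin_eq_one_of_prime`, from `C(W)` odd and `Δ_W < 0`). Its three displayed
print facts are tree theorems now (`MazurRubin2010.cor34i_singleton_rat_holds`, gk2-p4 g12; `poitouTate_selmerStructure_duality_real_holds`;
`localEulerPoincareCharacteristic_holds`), so everything below is UNCONDITIONAL:

* §1 `exists_prime_heegnerField_minimalTwin_depth_supply` — the depth supply with `h34`, `hPT`, `hEP` DISCHARGED (statement otherwise
  verbatim): beyond every bound a prime `ℓ₀ ≡ 7 (8)`, `K = ℚ(√−ℓ₀)` with EVERY K-clause of crux 22136 and `2` split, a globally minimal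
  `2`-Selmer-minimal twin `Wd ≅ W^{(−ℓ₀)}`, and for every `P ∈ Wd(ℚ) ∖ 2Wd(ℚ)`, every `M ≥ 1` and every finite exclusion a Kolyvagin prime
  `ℓ ≡ 7 (8)` of depth `M` whose genus pair is `2`-Selmer-minimal (`#Sel₂ = (2, 1)` for every model).
* §2 `zhang_isKolyvaginPrime_of_depth` — bookkeeping: Gross's Kolyvagin prime + `2^M ∣ ℓ+1 ∧ 2^M ∣ a_ℓ` (`M ≥ 1`) is a Zhang–Kolyvagin prime
  at `2` with `M ≤ kolyvaginIndex W 2 ℓ` — the currency of L_T's `hPn` and of the LINE 18 engine's frame `hTK` (`2 ≤ kolyvaginIndex`).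
* §3 **`exists_prime_heegnerField_minimalTwin_depth_supply_genusBudget_one`** — on the L_T habitat (`W` globally minimal, `C(W)` odd,
  `Δ_W < 0`, `2`-adic tower onto, `#Sel₂(W) = 4`): the same supply WITH the (E1) conjunct **`padicValNat 2 Wd.tamagawaProduct = 1`** and the
  (β″) conjuncts **`Zhang2014.IsKolyvaginPrime (N_W) W K 2 ℓ ∧ M ≤ Zhang2014.kolyvaginIndex W 2 ℓ`** at every requested depth `M`.
  READING for the pen: on the supply side, (E1) and (β″) cost NOTHING for `#Sel₂(W) = 4` — the supply's own `K` has prime `|d_K|`, hence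
  `B = 1`, so at that `K` the Deep stub of LINE 18 is vacuous and (LEAD memo g16 §3) the bottom-rung residual R⁽¹⁾ is void. What the supply
  does NOT give is U itself (stmt-24947, `MultiGenusPrimitivityAtTwo`: the `2`-primitivity certificate at the supplied level) — unchanged, OPEN.
* §4 `exists_prime_heegnerField_minimalTwin_genusBudget_one` — the (E1) reading for BOTH `2`-Selmer sizes the supply lineage serves
  (`#Sel₂(W) ∈ {1, 4}`, LEAD g10's unconditional SUPPLY″ `GenusKolyPR.supply_DEF1_minimalTwin_habitat`): on `Δ_W < 0`, `C(W)` odd, beyond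
  every bound a prime Heegner field with every K-clause of crux 22136, `2` split, and a globally minimal `2`-Selmer-minimal twin of genus
  budget `ord₂ C(Wd) = 1` (no Kolyvagin-prime clause here).

Honest framing: assembly of tree theorems; the twin's analytic rank one is NOT asserted (it is the line's (CONV₂)/GZ input); crux 22136 stays
OPEN exactly at (U) ∧ (CONV₂); BSD is not proved by any of this.

References: [MazurRubin2010] Prop. 3.3, Cor. 3.4 (i), Lemma 2.11, Lemma 3.5; [Kramer1981] §2 Prop. 3; [GrossLMS1991] §3 (3.1)–(3.3);
[WZhang2014] Notations (xii); [MilneADT2006] I Thm. 2.8, Thm. 4.10.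
-/

set_option linter.dupNamespace false -- tree convention: `Summit.BirchSwinnertonDyer.BirchSwinnertonDyer.Theorems` (summit = sub-problem)
set_option autoImplicit false

noncomputable section

open scoped Classical Pointwise

namespace Summit.BirchSwinnertonDyer.BirchSwinnertonDyer.Theorems.GenusKolyTwistingPrime

open WeierstrassCurve NumberField IsDedekindDomain Field
open Literature.NumberTheory.GaloisRepresentations Literature.NumberTheory.EllipticCurves
open Literature.NumberTheory Literature.NumberTheory.GaloisCohomology
open Summit.BirchSwinnertonDyer.BirchSwinnertonDyer.Theorems.SchneiderFreeAdditiveX3.PoitouTateReduction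
  (poitouTate_selmerStructure_duality_real_holds)

section Supply

variable (W : WeierstrassCurve ℚ) [W.IsElliptic] [W.IsGloballyMinimal]

/-! ## §1 The depth supply, unconditionally -/

/-- **THE DEPTH-`M` PRIME-HEEGNER-FIELD SUPPLY, UNCONDITIONALLY** — gk2-p4 g10's
`exists_prime_heegnerField_minimalTwin_depth_supply_of_cor34i` with its three displayed print facts DISCHARGED by tree theorems
(`MazurRubin2010.cor34i_singleton_rat_holds`, `poitouTate_selmerStructure_duality_real_holds ℚ`, `localEulerPoincareCharacteristic_holds`);
statement otherwise VERBATIM. `W/ℚ` globally minimal, `Δ_W < 0`, `ρ_{W,2^n}` onto for all `n ≥ 1`, `#Sel₂(W) = 4`. Beyond every bound `b`: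
a prime `ℓ₀ ≡ 7 (mod 8)`, `ℓ₀ ∤ 2N_W`, the Heegner field `K = ℚ(√−ℓ₀)` with every K-clause of crux 22136 and `2` split, a globally minimal
twin `Wd ≅ W^{(−ℓ₀)}` with `#Sel₂(Wd) = 2`, and for every `P ∈ Wd(ℚ)` with no `Γ_ℚ`-fixed half, every `M ≥ 1`, every finite `B₀`, a prime
`ℓ ≡ 7 (mod 8)` outside `B₀`, Kolyvagin for `(W, K, 2)` of depth `M` (`Frob_ℓ = Frob_∞` on `E[2^M]`, `2^M ∣ ℓ + 1`, `2^M ∣ a_ℓ`), every model of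
`W^{(−ℓ)}` having `#Sel₂ = 2` and every model of `Wd^{(−ℓ)}` having `#Sel₂ = 1`. U is untouched; BSD is not proved by this.
[cite: MazurRubin2010, Cor. 3.4 (i), Prop. 3.3, Lemma 2.11, Lemma 3.5] [cite: GrossLMS1991, §3 (3.1)–(3.3), §9] [cite: MilneADT2006, I Thm. 2.8, Thm. 4.10] -/
theorem exists_prime_heegnerField_minimalTwin_depth_supply
    (hρ : ∀ n : ℕ, 0 < n → W.HasSurjectiveModNGaloisRep ((2 : ℤ) ^ n)) (hΔ : W.Δ < 0)
    (h4 : Nat.card (W.selmerGroup 2) = 4) (b : ℕ) :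
    ∃ ℓ₀ : ℕ, ℓ₀.Prime ∧ b < ℓ₀ ∧ ℓ₀ % 8 = 7 ∧ ¬ ℓ₀ ∣ 2 * W.conductorNorm ℤ ∧
      ∃ (K : Type) (_ : Field K) (_ : NumberField K), IsImaginaryQuadratic K ∧ discr K = -(ℓ₀ : ℤ) ∧ Odd (discr K) ∧
        discr K ≠ -3 ∧ SatisfiesHeegnerHypothesis (W.conductorNorm ℤ) K ∧
        ¬ IsSquare ((discr K : ℚ) * -|W.Δ|) ∧ ¬ IsSquare ((discr K : ℚ) * (-(2 * |W.Δ|))) ∧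
        ((Ideal.span {(2 : ℤ)}).primesOver (𝓞 K)).ncard = 2 ∧
        ∃ (Wd : WeierstrassCurve ℚ) (_ : Wd.IsElliptic) (_ : Wd.IsGloballyMinimal),
          (∃ C : VariableChange ℚ, C • W.quadraticTwist (discr K : ℚ) = Wd) ∧ Nat.card (Wd.selmerGroup 2) = 2 ∧
          ∀ (P : Wd.toAffine.Point) (Q : geomPoints Wd), (2 : ℤ) • Q = toGeomPoints Wd P →
            (∀ T ∈ geomTorsion Wd (2 : ℤ), Q - T ∉ MulAction.fixedPoints (absoluteGaloisGroup ℚ) (geomPoints Wd)) →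
            ∀ {M : ℕ}, 1 ≤ M → ∀ B₀ : Finset ℕ,
              ∃ ℓ : ℕ, ∃ _ : Fact ℓ.Prime, ℓ ∉ B₀ ∧ ℓ % 8 = 7 ∧ IsKolyvaginPrime (W.conductorNorm ℤ) W K 2 ℓ ∧
                FrobEqFrobInfty W K (2 ^ M) ℓ ∧ 2 ^ M ∣ ℓ + 1 ∧ ((2 : ℤ) ^ M) ∣ W.frobeniusTrace ℓ ∧
                (∀ (W₁ : WeierstrassCurve ℚ) [W₁.IsElliptic],
                  (∃ C₁ : VariableChange ℚ, C₁ • W.quadraticTwist (-(ℓ : ℚ)) = W₁) →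
                    Nat.card (W₁.selmerGroup 2) = 2) ∧
                (∀ (W₂ : WeierstrassCurve ℚ) [W₂.IsElliptic],
                  (∃ C₂ : VariableChange ℚ, C₂ • Wd.quadraticTwist (-(ℓ : ℚ)) = W₂) →
                    Nat.card (W₂.selmerGroup 2) = 1) := by
  have hEP : ∀ v : HeightOneSpectrum (𝓞 ℚ), localEulerPoincareCharacteristic (v.adicCompletion ℚ) := fun v ↦
    haveI : CharZero (v.adicCompletion ℚ) := charZero_of_injective_algebraMap (algebraMap ℚ _).injective
    localEulerPoincareCharacteristic_holds (v.adicCompletion ℚ)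
  exact exists_prime_heegnerField_minimalTwin_depth_supply_of_cor34i W MazurRubin2010.cor34i_singleton_rat_holds
    (poitouTate_selmerStructure_duality_real_holds (K := ℚ)) hEP hρ hΔ h4 b

/-! ## §2 Bookkeeping: Gross's Kolyvagin prime of depth `M` is a Zhang–Kolyvagin prime of index `≥ M` -/

omit [W.IsElliptic] in
/-- **Depth `M ≥ 1` in the two currencies.** A Gross–Kolyvagin prime `ℓ` for `(W, K, 2)` at level `N` (Gross 1991 (3.1)–(3.2)) with
`2^M ∣ ℓ + 1` and `2^M ∣ a_ℓ` for some `M ≥ 1` is a Zhang–Kolyvagin prime at `2` (Zhang 2014, Notations (xii): index `M(ℓ) > 0`) with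
`M ≤ M(ℓ) = kolyvaginIndex W 2 ℓ` (`Zhang2014.le_kolyvaginIndex_iff`). [cite: WZhang2014, Notations (xii)] [cite: GrossLMS1991, §3 (3.1)–(3.3)] -/
theorem zhang_isKolyvaginPrime_of_depth {N : ℕ} {K : Type} [Field K] [NumberField K] {ℓ M : ℕ} (hM : 1 ≤ M)
    (hℓ : IsKolyvaginPrime N W K 2 ℓ) (hdvd : 2 ^ M ∣ ℓ + 1) (ha : ((2 : ℤ) ^ M) ∣ W.frobeniusTrace ℓ) :
    Zhang2014.IsKolyvaginPrime N W K 2 ℓ ∧ M ≤ Zhang2014.kolyvaginIndex W 2 ℓ := by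
  haveI : Fact (Nat.Prime 2) := ⟨Nat.prime_two⟩
  have hidx : M ≤ Zhang2014.kolyvaginIndex W 2 ℓ :=
    (Zhang2014.le_kolyvaginIndex_iff (W := W) (p := 2)).mpr ⟨hdvd, by exact_mod_cast ha⟩
  exact ⟨⟨hℓ.1, hℓ.2.1, hℓ.2.2.1, hℓ.2.2.2.1, hℓ.2.2.2.2.1, lt_of_lt_of_le hM hidx⟩, hidx⟩

/-! ## §3 The supply delivers (E1) «B = 1» and (β″) «index ≥ M» -/

/-- **THE SUPPLY DELIVERS THE HABITAT CUT (E1) AND THE INDEX-≥M PRIMES (β″), UNCONDITIONALLY.** On the L_T habitat — `W/ℚ` globally minimal,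
`C(W) = ∏ c_p` ODD, `Δ_W < 0`, `ρ_{W,2^n}` onto for all `n ≥ 1` — with `#Sel₂(W) = 4`: beyond every bound `b` a prime `ℓ₀ ≡ 7 (mod 8)`,
`ℓ₀ ∤ 2N_W`, the Heegner field `K = ℚ(√−ℓ₀)` carrying EVERY K-clause of crux 22136 (imaginary quadratic, `d_K = −ℓ₀` odd, `≠ −3`, Heegner for
`N_W`, `d_K·(−|Δ|)` and `d_K·(−2|Δ|)` non-squares, `2` split), a globally minimal twin `Wd ≅ W^{(d_K)}` with `#Sel₂(Wd) = 2` AND GENUS BUDGET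
**`ord₂ C(Wd) = 1`** (the habitat cut (E1) of LINE 18: `|d_K|` prime ⟹ `B = 1`, gk2-p2 `padicValNat_two_tamagawaProduct_twin_eq_one_of_prime`),
and, for every `P ∈ Wd(ℚ)` with no `Γ_ℚ`-fixed half (exists as soon as `rank Wd(ℚ) ≥ 1`), every depth `M ≥ 1` and every finite exclusion `B₀`,
a prime `ℓ ≡ 7 (mod 8)` outside `B₀` which is a **Zhang–Kolyvagin prime at `2` of index `≥ M`** (`M ≤ kolyvaginIndex W 2 ℓ`, the currency of
L_T's `hPn` and of the bottom-rung engine's frame; (β″) is `M = 2`), Gross–Kolyvagin with `Frob_ℓ = Frob_∞` on `E[2^M]`, and whose genus pair is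
`2`-Selmer-minimal (`#Sel₂(W^{(−ℓ)}) = 2`, `#Sel₂(Wd^{(−ℓ)}) = 1` for every model). So on the supply side (E1) ∧ (β″) are FREE for `#Sel₂(W) = 4`;
what remains is U (stmt-24947) at the supplied level. The twin's analytic rank is NOT asserted; BSD is not proved by this.
[cite: MazurRubin2010, Cor. 3.4 (i), Prop. 3.3, Lemma 2.11, Lemma 3.5] [cite: Kramer1981, §2 Prop. 3] [cite: WZhang2014, Notations (xii)]
[cite: GrossLMS1991, §3 (3.1)–(3.3), §9] -/
theorem exists_prime_heegnerField_minimalTwin_depth_supply_genusBudget_one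
    (hρ : ∀ n : ℕ, 0 < n → W.HasSurjectiveModNGaloisRep ((2 : ℤ) ^ n)) (hΔ : W.Δ < 0) (hT : Odd W.tamagawaProduct)
    (h4 : Nat.card (W.selmerGroup 2) = 4) (b : ℕ) :
    ∃ ℓ₀ : ℕ, ℓ₀.Prime ∧ b < ℓ₀ ∧ ℓ₀ % 8 = 7 ∧ ¬ ℓ₀ ∣ 2 * W.conductorNorm ℤ ∧
      ∃ (K : Type) (_ : Field K) (_ : NumberField K), IsImaginaryQuadratic K ∧ discr K = -(ℓ₀ : ℤ) ∧ Odd (discr K) ∧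
        discr K ≠ -3 ∧ SatisfiesHeegnerHypothesis (W.conductorNorm ℤ) K ∧
        ¬ IsSquare ((discr K : ℚ) * -|W.Δ|) ∧ ¬ IsSquare ((discr K : ℚ) * (-(2 * |W.Δ|))) ∧
        ((Ideal.span {(2 : ℤ)}).primesOver (𝓞 K)).ncard = 2 ∧
        ∃ (Wd : WeierstrassCurve ℚ) (_ : Wd.IsElliptic) (_ : Wd.IsGloballyMinimal),
          (∃ C : VariableChange ℚ, C • W.quadraticTwist (discr K : ℚ) = Wd) ∧ Nat.card (Wd.selmerGroup 2) = 2 ∧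
          padicValNat 2 Wd.tamagawaProduct = 1 ∧
          ∀ (P : Wd.toAffine.Point) (Q : geomPoints Wd), (2 : ℤ) • Q = toGeomPoints Wd P →
            (∀ T ∈ geomTorsion Wd (2 : ℤ), Q - T ∉ MulAction.fixedPoints (absoluteGaloisGroup ℚ) (geomPoints Wd)) →
            ∀ {M : ℕ}, 1 ≤ M → ∀ B₀ : Finset ℕ,
              ∃ ℓ : ℕ, ∃ _ : Fact ℓ.Prime, ℓ ∉ B₀ ∧ ℓ % 8 = 7 ∧ IsKolyvaginPrime (W.conductorNorm ℤ) W K 2 ℓ ∧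
                Zhang2014.IsKolyvaginPrime (W.conductorNorm ℤ) W K 2 ℓ ∧ M ≤ Zhang2014.kolyvaginIndex W 2 ℓ ∧
                FrobEqFrobInfty W K (2 ^ M) ℓ ∧ 2 ^ M ∣ ℓ + 1 ∧ ((2 : ℤ) ^ M) ∣ W.frobeniusTrace ℓ ∧
                (∀ (W₁ : WeierstrassCurve ℚ) [W₁.IsElliptic],
                  (∃ C₁ : VariableChange ℚ, C₁ • W.quadraticTwist (-(ℓ : ℚ)) = W₁) →
                    Nat.card (W₁.selmerGroup 2) = 2) ∧
                (∀ (W₂ : WeierstrassCurve ℚ) [W₂.IsElliptic],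
                  (∃ C₂ : VariableChange ℚ, C₂ • Wd.quadraticTwist (-(ℓ : ℚ)) = W₂) →
                    Nat.card (W₂.selmerGroup 2) = 1) := by
  obtain ⟨ℓ₀, hℓ₀, hb, hℓ₀8, hℓ₀N, K, _, _, hK, hd, hodd, hd3, hH, hsq1, hsq2, h2K, Wd, _, _, hWd, hSelWd, hsup⟩ :=
    exists_prime_heegnerField_minimalTwin_depth_supply W hρ hΔ h4 b
  have hprime : (discr K).natAbs.Prime := by
    rw [hd, Int.natAbs_neg, Int.natAbs_natCast]
    exact hℓ₀
  obtain ⟨Cd, hCd⟩ := hWd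
  have hB : padicValNat 2 Wd.tamagawaProduct = 1 :=
    GenusExact.PlusDescent.padicValNat_two_tamagawaProduct_twin_eq_one_of_prime W hK hodd hH hT hΔ hprime Cd hCd
  refine ⟨ℓ₀, hℓ₀, hb, hℓ₀8, hℓ₀N, K, inferInstance, inferInstance, hK, hd, hodd, hd3, hH, hsq1, hsq2, h2K, Wd,
    inferInstance, inferInstance, ⟨Cd, hCd⟩, hSelWd, hB, ?_⟩
  intro P Q hQ hP M hM B₀
  obtain ⟨ℓ, hℓF, hℓB, hℓ8, hKol, hFrob, hdvd, ha, hS1, hS2⟩ := hsup P Q hQ hP (M := M) hM B₀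
  obtain ⟨hZ, hidx⟩ := zhang_isKolyvaginPrime_of_depth W hM hKol hdvd ha
  exact ⟨ℓ, hℓF, hℓB, hℓ8, hKol, hZ, hidx, hFrob, hdvd, ha, hS1, hS2⟩

/-! ## §4 (E1) for both `2`-Selmer sizes of the supply lineage -/

/-- **A `B = 1` MINIMAL PRIME HEEGNER TWIN BEYOND EVERY BOUND, for `#Sel₂(W) ∈ {1, 4}`, UNCONDITIONALLY.** `W/ℚ` globally minimal elliptic,
`ρ_{W,2^n}` onto for all `n ≥ 1`, `Δ_W < 0`, `C(W)` odd, `#Sel₂(W) ∈ {1, 4}`: beyond every bound `b` a prime `ℓ ≡ 7 (mod 8)`, `ℓ ∤ N_W`, the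
Heegner field `K = ℚ(√−ℓ)` with every K-clause of crux 22136 and `2` split, and a globally minimal twin `Wd ≅ W^{(−ℓ)}` with `#Sel₂(Wd) = 2`
and genus budget `ord₂ C(Wd) = 1` — the habitat cut (E1) of LINE 18 holds at the supply's own Heegner field (LEAD g10's
`GenusKolyPR.supply_DEF1_minimalTwin_habitat` + gk2-p2 g17's `padicValNat_two_tamagawaProduct_twin_eq_one_of_prime`). The twin's analytic
rank is NOT asserted; BSD is not proved by this. [cite: MazurRubin2010, Thm. 2.7, Prop. 3.3, Cor. 3.4 (i)] [cite: Kramer1981, §2 Prop. 3]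
[cite: GrossLMS1991, §1 (p. 235)] -/
theorem exists_prime_heegnerField_minimalTwin_genusBudget_one
    (hρ : ∀ n : ℕ, 0 < n → W.HasSurjectiveModNGaloisRep ((2 : ℤ) ^ n)) (hΔ : W.Δ < 0) (hT : Odd W.tamagawaProduct)
    (h14 : Nat.card (W.selmerGroup 2) = 1 ∨ Nat.card (W.selmerGroup 2) = 4) (b : ℕ) :
    ∃ ℓ : ℕ, b < ℓ ∧ ℓ.Prime ∧ ℓ % 8 = 7 ∧ ¬ ℓ ∣ W.conductorNorm ℤ ∧
      ∃ (K : Type) (_ : Field K) (_ : NumberField K), IsImaginaryQuadratic K ∧ discr K = -(ℓ : ℤ) ∧ Odd (discr K) ∧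
        discr K ≠ -3 ∧ SatisfiesHeegnerHypothesis (W.conductorNorm ℤ) K ∧
        ¬ IsSquare ((discr K : ℚ) * -|W.Δ|) ∧ ¬ IsSquare ((discr K : ℚ) * (-(2 * |W.Δ|))) ∧
        ((Ideal.span {(2 : ℤ)}).primesOver (𝓞 K)).ncard = 2 ∧
        ∃ (Wd : WeierstrassCurve ℚ) (_ : Wd.IsElliptic) (_ : Wd.IsGloballyMinimal),
          (∃ C : VariableChange ℚ, C • W.quadraticTwist (discr K : ℚ) = Wd) ∧ Nat.card (Wd.selmerGroup 2) = 2 ∧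
          padicValNat 2 Wd.tamagawaProduct = 1 := by
  have hε : 0 < W.Δ → Nat.card (W.selmerGroup 2) = 4 → ¬ Summit.BirchSwinnertonDyer.Rank1Residual.F1Sign2.DescentSignNeg W :=
    fun h _ ↦ absurd h (not_lt.mpr hΔ.le)
  obtain ⟨ℓ, hbℓ, hℓ, hℓ8, hℓN, -, K, _, _, hK, hd, hodd, hd3, hH, hsq1, hsq2, h2K, Wd, _, _, hWd, hSelWd⟩ :=
    GenusKolyPR.supply_DEF1_minimalTwin_habitat W hρ h14 hε b
  have hprime : (discr K).natAbs.Prime := by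
    rw [hd, Int.natAbs_neg, Int.natAbs_natCast]
    exact hℓ
  obtain ⟨Cd, hCd⟩ := hWd
  exact ⟨ℓ, hbℓ, hℓ, hℓ8, hℓN, K, inferInstance, inferInstance, hK, hd, hodd, hd3, hH, hsq1, hsq2, h2K, Wd, inferInstance,
    inferInstance, ⟨Cd, hCd⟩, hSelWd,
    GenusExact.PlusDescent.padicValNat_two_tamagawaProduct_twin_eq_one_of_prime W hK hodd hH hT hΔ hprime Cd hCd⟩

end Supply

end Summit.BirchSwinnertonDyer.BirchSwinnertonDyer.Theorems.GenusKolyTwistingPrime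

end
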